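import Literature.NumberTheory.EllipticCurves.Castella2018.AnticyclotomicSelmer
import Literature.NumberTheory.EllipticCurves.IwasawaSelmerDualProofs
import Literature.NumberTheory.EllipticCurves.IwasawaAlgebra
import Literature.NumberTheory.EllipticCurves.AdditiveReductionSemistableModelProofs
import HarnessLib

/-!
# Castella 2018, Def. 2.2 / §2.2 — the `Λ`-dual `X_ac^Σ(E[p^∞])` of the anticyclotomic Selmer group
# as a `ℤ_p⟦T⟧`-module, its characteristic ideal, and the shape "`ord_p f_ac^Σ(0) = n`"
# (the Literature object; sequel of `AnticyclotomicSelmer.lean`)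

HONEST FRAMING (cell `b2b-bsdres`, run/shared/lean/b2b/bsd-rank1-residual/, verbatim in every file):
the goal of the cell is to DELETE the COMBINATION-SHAPED residual classes of the Birch–Swinnerton-Dyer
formula for ALL analytic-rank `≤ 1` elliptic curves over `ℚ` — "full BSD formula for every rank
`≤ 1` curve in class `C`" assembled STRICTLY from published theorems — so that the rank-`≤ 1`
remainder becomes exactly the CONSTRUCTION-SHAPED classes, which are TYPED (missing-input `Prop`s),
NOT attempted. This is not "finishing BSD". Unit `b2b-bsdres-lit-cgls` (off-peak literature typer),
session 5; sized ask S1a (`HOME/b2b-bsdres-lit-cgls/CGLS-GV-TYPING.md` §6) = A1′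
(`HOME/b2b-bsdres-lit-glue/GLUE.md` §G3.4). Definitions with bodies, instances, proved theorems and
ONE `Prop`-valued predicate with parameters naming a printed shape; nothing asserted; no named fact;
no `sorry`. Deprecate-and-add, phase "add": the declarations are those of the Summits file
`Summits/BirchSwinnertonDyer/Rank1Residual/X11b/AnticyclotomicSelmerDual.lean` (p215153, multr1,
2026-08-19) re-homed with the same names, binders and bodies under
`Literature.NumberTheory.EllipticCurves.Castella2018.AcSelmer` (so the Summits twins are
definitionally equal to these and re-point by `rfl` adapters; their retirement is their owners').

## Source, verbatim

Castella, Camb. J. Math. 6 (2018) §2.1 (arXiv:1704.06608 p. 5; held text `paper:arxiv-1704.06608`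
p0005 L69–L73, L89–L91, L93–L98): "Set `X_ac^Σ(E[p^∞]) := Hom_{ℤ_p}(Sel_𝔭^Σ(K_∞, E[p^∞]), ℚ_p/ℤ_p)`,
which is easily shown to be a finitely generated `Λ`-module"; §2.2: "Letting `γ ∈ Γ` be a fixed
topological generator, we identify the one-variable power series ring `ℤ_p[[T]]` with the Iwasawa
algebra `Λ = ℤ_p[[Γ]]` by sending `1 + T ↦ γ`"; Thm. 2.3: "… `X_ac^Σ(E[p^∞])` is `Λ`-torsion, and
letting `f_ac^Σ(T) ∈ Λ` be a generator of `Ch_Λ(X_ac^Σ(E[p^∞]))`, we have `#ℤ_p/f_ac^Σ(0) = …`".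
Castella–Grossi–Lee–Skinner, Invent. Math. 227 (2022) §2.3 / Thm. 5.1.1 (arXiv:2008.02571v2 TeX L857,
L2411–L2414): "`𝔛_E := H¹_{𝓕_Gr}(K, M_E)^∨`", "`𝔛_E` is a torsion `Λ`-module, and letting `𝓕_E ∈ Λ`
be a generator of `char_Λ(𝔛_E)`, we have `#ℤ_p/𝓕_E(0) = …`" — the same module (Castella's `𝔭` = CGLS's
`v̄`) and the same left-hand side.

## Content

* `conjSelmerAc W p κ 𝔭 S γ`: `conj_γ` as an endomorphism of `Sel_𝔭^Σ(K_∞, E[p^∞])`;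
  **`isLocNil_conjSelmerAc_sub_one`**: for a topological generator `γ`, `conj_γ − 1` is locally
  nilpotent on the `p`-primary group `Sel_𝔭^Σ` (verbatim the argument of
  `WeierstrassCurve.isLocNil_conjSelmerInfty_sub_one` for the classical Selmer group: compactness of
  `Gal(K̄/K_∞)`, continuity of the `Γ`-action, `(γ − 1)^{kp^a}` kills a `p^k`-torsion class fixed by
  `γ^{p^a}`).
* **`XAc W p κ 𝔭 S γ = X_ac^Σ(E[p^∞]) := Hom(Sel_𝔭^Σ(K_∞, E[p^∞]), ℚ/ℤ)`** (`ℚ/ℤ = AddCircle (1 : ℚ)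
  ⊇ ℚ_p/ℤ_p` receives every character of the torsion group `Sel`, as in
  `WeierstrassCurve.SelmerDualData`), a type depending on `γ` (`[Fact (κ.IsTopGenerator γ)]`), with
  its `Λ = ℤ_p⟦T⟧ = IwasawaAlgebra p`-MODULE STRUCTURE `instModuleXAc` = `IwasawaDual.IsLocNil.module`
  — CONSTRUCTED, not assumed; `XAc.X_smul_apply` (`(T·x)(s) = x(conj_γ s) − x(s)`) and
  `XAc.C_smul_apply` (constants through `ℤ_p → ℤ/p^k`) certify the action is Castella's `1 + T ↦ γ`.
* **`XAc.charIdeal = Ch_Λ(X_ac^Σ(E[p^∞]))`** (the tree's `Module.charIdeal`).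
* `valuation_constantCoeff_eq_of_span_singleton_eq`: if `(f) = (g)` in `Λ` and `f(0) ≠ 0` then
  `g(0) ≠ 0` and `ord_p g(0) = ord_p f(0)` — "`#ℤ_p/f_ac^Σ(0)`" does not depend on the generator.
* `XAc.HasCharValuationAt … n` — the SHAPE "`X_ac^Σ` is `Λ`-torsion, `Ch_Λ(X_ac^Σ) = (f)` with
  `f(0) ≠ 0` and `ord_p f(0) = n`" ON THE REAL MODULE (the left-hand side of Cas18 Thm. 2.3, of CGLS
  Thm. 5.1.1 and of Castella §5 (5.1)); `XAc.HasCharValuationAt.unique`: `n` is well defined. A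
  predicate; nothing asserted.

Nothing is asserted about finite generation, cotorsion, control or the main conjectures; those are
the PUBLISHED THEOREMS to be vendored as named facts on this object (first:
`CastellaGrossiLeeSkinner2022/AnticyclotomicControl.lean`).

References: [Castella2018] §2.1 Def. 2.2, §2.2, Thm. 2.3 (arXiv:1704.06608 p. 5), §5 (5.1) (p. 12);
[Castella2018Erratum] Thm. 1.1; [CastellaGrossiLeeSkinner2022] §2.3, Thm. 5.1.1; [GreenbergLNM1716]
§1; [Lang1990] Ch. 5 §1; [Mazur1972] §6; HOME/b2b-bsdres-lit-cgls/CGLS-GV-TYPING.md §12.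
-/

noncomputable section

open scoped Classical

open NumberField IsDedekindDomain Field
open Literature.NumberTheory.EllipticCurves Literature.NumberTheory.EllipticCurves.GreenbergSelmer
open Literature.NumberTheory.GaloisRepresentations

universe u

namespace Literature.NumberTheory.EllipticCurves.Castella2018.AcSelmer

variable {K : Type u} [Field K] [NumberField K]

/-! ## The `Γ`-action on `Sel_𝔭^Σ(K_∞, E[p^∞])` and local nilpotence of `γ − 1` -/

section Curve

variable (W : WeierstrassCurve K) (p : ℕ) [Fact p.Prime]
  (κ : ZpExtension K p) (𝔭 : HeightOneSpectrum (𝓞 K)) (S : Set (HeightOneSpectrum (𝓞 K)))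

/-- `conj_γ` restricted to an endomorphism of `Sel_𝔭^Σ(K_∞, E[p^∞])`.
[cite: Castella2018, §2.1 (arXiv:1704.06608 p. 5)] -/
def conjSelmerAc (γ : absoluteGaloisGroup K) : AddMonoid.End (selmerAc W p κ 𝔭 S) :=
  ((W.conjH1 p κ.kerSubgroup γ).restrict (selmerAc W p κ 𝔭 S)).codRestrict (selmerAc W p κ 𝔭 S)
    fun s ↦ conjH1_mem_selmerAc γ s.2

/-- Unfolding `conjSelmerAc`: on classes it is `conj_γ` (definitional) — the `Γ`-action on
`Sel_𝔭^Σ(K_∞, E[p^∞])` of Cas18 §2.1–2.2. [cite: Castella2018, §2.1–2.2 (arXiv:1704.06608 p. 5), the `Γ`-action on `Sel_𝔭^Σ`] -/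
@[simp]
theorem coe_conjSelmerAc_apply (γ : absoluteGaloisGroup K) (s : selmerAc W p κ 𝔭 S) :
    ((conjSelmerAc W p κ 𝔭 S γ s : selmerAc W p κ 𝔭 S) : W.subgroupH1 p κ.kerSubgroup) =
      W.conjH1 p κ.kerSubgroup γ s :=
  rfl

/-- Powers of the restriction are restrictions of `conj_{γ^m}` (the `Γ`-action of Cas18 §2.1–2.2 is an
action). [cite: Castella2018, §2.1–2.2 (arXiv:1704.06608 p. 5), the `Γ`-action on `Sel_𝔭^Σ`] -/
theorem coe_conjSelmerAc_pow_apply (γ : absoluteGaloisGroup K) (m : ℕ) (s : selmerAc W p κ 𝔭 S) :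
    ((((conjSelmerAc W p κ 𝔭 S γ) ^ m) s : selmerAc W p κ 𝔭 S) : W.subgroupH1 p κ.kerSubgroup) =
      W.conjH1 p κ.kerSubgroup (γ ^ m) s := by
  induction m generalizing s with
  | zero => rw [pow_zero, pow_zero, AddMonoid.End.one_apply, W.conjH1_one_holds p κ.kerSubgroup,
      AddMonoidHom.id_apply]
  | succ m ih =>
    rw [pow_succ, AddMonoid.End.coe_mul, Function.comp_apply, ih, coe_conjSelmerAc_apply,
      pow_succ, W.conjH1_mul_holds p κ.kerSubgroup, AddMonoidHom.comp_apply]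

/-- **`Sel_𝔭^Σ(K_∞, E[p^∞])` is `p`-primary and `T = γ − 1` is locally nilpotent on it** for `γ` a
topological generator of `Gal(K_∞/K)`: every class is killed by some `p^k` (compactness of
`Gal(K̄/K_∞)`, `WeierstrassCurve.exists_pow_smul_subgroupH1_ker_eq_zero`) and fixed by some
`conj_{γ^{p^a}}` (continuity, `WeierstrassCurve.exists_conjH1_pow_prime_pow_eq`), hence killed by
`(conj_γ − 1)^{k p^a}` (`IwasawaDual.pow_mul_prime_pow_apply_eq_zero`). Verbatim the argument of
`WeierstrassCurve.isLocNil_conjSelmerInfty_sub_one` for the classical Selmer group.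
[cite: GreenbergLNM1716, §1 (after Conj. 1.3)] [cite: Castella2018, §2.2 (arXiv:1704.06608 p. 5)] -/
theorem isLocNil_conjSelmerAc_sub_one {γ : absoluteGaloisGroup K} (hγ : κ.IsTopGenerator γ) :
    IwasawaDual.IsLocNil p (conjSelmerAc W p κ 𝔭 S γ - 1) := by
  have htor : ∀ s : selmerAc W p κ 𝔭 S, ∃ k : ℕ, p ^ k • s = 0 := fun s ↦ by
    obtain ⟨k, hk⟩ := W.exists_pow_smul_subgroupH1_ker_eq_zero κ (s : W.subgroupH1 p κ.kerSubgroup)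
    exact ⟨k, Subtype.ext (by rw [AddSubgroupClass.coe_nsmul]; exact hk)⟩
  refine ⟨htor, fun s ↦ ?_⟩
  obtain ⟨a, ha⟩ := W.exists_conjH1_pow_prime_pow_eq κ hγ (s : W.subgroupH1 p κ.kerSubgroup)
  obtain ⟨k, hk⟩ := htor s
  have hφ : ((conjSelmerAc W p κ 𝔭 S γ) ^ p ^ a) s = s :=
    Subtype.ext (by rw [coe_conjSelmerAc_pow_apply]; exact ha)
  exact ⟨k * p ^ a, IwasawaDual.pow_mul_prime_pow_apply_eq_zero (Fact.out : p.Prime) _ a hφ hk⟩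

/-- **`X_ac^Σ(E[p^∞]) := Hom(Sel_𝔭^Σ(K_∞, E[p^∞]), ℚ/ℤ)`**, the Pontryagin dual of Castella's Selmer
group ("`X_ac^Σ(E[p^∞]) := Hom_{ℤ_p}(Sel_𝔭^Σ(K_∞,E[p^∞]), ℚ_p/ℤ_p)`"; `ℚ/ℤ = AddCircle (1 : ℚ)`
receives every character of the torsion group `Sel`, as in `WeierstrassCurve.SelmerDualData`), as a
type depending on a topological generator `γ` of `Gal(K_∞/K)` (instance argument
`[Fact (κ.IsTopGenerator γ)]`) through which it is a `Λ = ℤ_p⟦T⟧`-module, `1 + T ↦ γ`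
(`instModuleXAc`). CGLS 2022's `𝔛_E = H¹_{𝓕_Gr}(K, M_E)^∨` (with `𝔭 = v̄`, `Σ = ∅`).
[cite: Castella2018, Def. 2.2 (arXiv:1704.06608 p. 5)]
[cite: CastellaGrossiLeeSkinner2022, §2.3 (`𝔛_E := H¹_{𝓕_Gr}(K, M_E)^∨`)] -/
def XAc (γ : absoluteGaloisGroup K) [Fact (κ.IsTopGenerator γ)] : Type u :=
  selmerAc W p κ 𝔭 S →+ AddCircle (1 : ℚ)

variable (γ : absoluteGaloisGroup K) [hγ : Fact (κ.IsTopGenerator γ)]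

/-- `X_ac^Σ` is an abelian group (pointwise). [folklore] -/
instance instAddCommGroupXAc : AddCommGroup (XAc W p κ 𝔭 S γ) :=
  inferInstanceAs (AddCommGroup (selmerAc W p κ 𝔭 S →+ AddCircle (1 : ℚ)))

/-- Elements of `X_ac^Σ` are functions on `Sel_𝔭^Σ` (characters). [folklore] -/
instance instFunLikeXAc : FunLike (XAc W p κ 𝔭 S γ) (selmerAc W p κ 𝔭 S) (AddCircle (1 : ℚ)) :=
  inferInstanceAs (FunLike (selmerAc W p κ 𝔭 S →+ AddCircle (1 : ℚ)) _ _)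

/-- Elements of `X_ac^Σ` are additive characters of `Sel_𝔭^Σ`. [folklore] -/
instance instAddMonoidHomClassXAc :
    AddMonoidHomClass (XAc W p κ 𝔭 S γ) (selmerAc W p κ 𝔭 S) (AddCircle (1 : ℚ)) :=
  inferInstanceAs (AddMonoidHomClass (selmerAc W p κ 𝔭 S →+ AddCircle (1 : ℚ)) _ _)

/-- **The `Λ = ℤ_p⟦T⟧`-module structure of `X_ac^Σ(E[p^∞])`**, `T` acting as `conj_γ − 1` and the
constants through `ℤ_p → ℤ/p^k` (`IwasawaDual.IsLocNil.module` for
`isLocNil_conjSelmerAc_sub_one`): "we identify … `ℤ_p[[T]]` with the Iwasawa algebra `Λ = ℤ_p[[Γ]]`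
by sending `1 + T ↦ γ`" (Cas18 §2.2). CONSTRUCTED, not assumed.
[cite: Castella2018, §2.2 (arXiv:1704.06608 p. 5)] [cite: GreenbergLNM1716, §1 (after Conj. 1.3)] -/
instance instModuleXAc : Module (IwasawaAlgebra p) (XAc W p κ 𝔭 S γ) :=
  (isLocNil_conjSelmerAc_sub_one W p κ 𝔭 S hγ.out).module

namespace XAc

/-- **`T` acts as `γ − 1`** on `X_ac^Σ`: `(T·x)(s) = x(conj_γ s) − x(s)`.
[cite: Castella2018, §2.2 (arXiv:1704.06608 p. 5), "`1 + T ↦ γ`"] -/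
theorem X_smul_apply (x : XAc W p κ 𝔭 S γ) (s : selmerAc W p κ 𝔭 S) :
    ((PowerSeries.X : IwasawaAlgebra p) • x) s = x (conjSelmerAc W p κ 𝔭 S γ s) - x s := by
  show (isLocNil_conjSelmerAc_sub_one W p κ 𝔭 S hγ.out).smulFun PowerSeries.X x s = _
  rw [(isLocNil_conjSelmerAc_sub_one W p κ 𝔭 S hγ.out).smulFun_X_apply, IwasawaDual.End_sub_apply,
    AddMonoid.End.one_apply, map_sub]
  rfl

/-- **Constants `c ∈ ℤ_p` act through `ℤ_p → ℤ/p^k`** on the value at a `p^k`-torsion class: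
`(c·x)(s) = (c mod p^k) · x(s)`. [cite: Lang1990, Ch. 5 §1] -/
theorem C_smul_apply (c : ℤ_[p]) (x : XAc W p κ 𝔭 S γ) {s : selmerAc W p κ 𝔭 S} {k : ℕ}
    (hk : p ^ k • s = 0) :
    ((PowerSeries.C c : IwasawaAlgebra p) • x) s = (PadicInt.toZModPow k c).val • x s := by
  show (isLocNil_conjSelmerAc_sub_one W p κ 𝔭 S hγ.out).smulFun (PowerSeries.C c) x s = _
  exact (isLocNil_conjSelmerAc_sub_one W p κ 𝔭 S hγ.out).smulFun_C_apply c x hk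

/-- **`Ch_Λ(X_ac^Σ(E[p^∞])) ⊆ Λ`**, the characteristic ideal of the `Λ`-module `X_ac^Σ` (the tree's
`Module.charIdeal`: product over height-one primes of `𝔮^{length(X_𝔮)}`; meaningful for finitely
generated torsion `X`, which is NOT asserted here — Cas18 Thm. 2.3 / CGLS Thm. 5.1.1 / erratum
Thm. 1.1 assert it under hypotheses). A generator is Castella's `f_ac^Σ(T)` = CGLS's `𝓕_E`.
[cite: Castella2018, Thm. 2.3 (arXiv:1704.06608 p. 5), "a generator of `Ch_Λ(X_ac^Σ(E[p^∞]))`"]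
[cite: CastellaGrossiLeeSkinner2022, Thm. 5.1.1 ("`𝓕_E ∈ Λ` a generator of `char_Λ(𝔛_E)`")] -/
def charIdeal : Ideal (IwasawaAlgebra p) :=
  Literature.NumberTheory.EllipticCurves.Module.charIdeal (IwasawaAlgebra p) (XAc W p κ 𝔭 S γ)

end XAc

end Curve

/-! ## "`ord_p f(0)`" for a generator `f` of a principal ideal of `Λ` is well defined -/

section Valuation

variable {p : ℕ} [Fact p.Prime]

/-- **Generator independence of `ord_p f(0)`.** If `(f) = (g)` in `Λ = ℤ_p⟦T⟧` and `f(0) ≠ 0`, then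
`g(0) ≠ 0` and `ord_p g(0) = ord_p f(0)`: `g = f·u` for a unit `u` of `Λ` (a domain), and `u(0)` is a
unit of `ℤ_p`. This is why "`#ℤ_p/f_ac^Σ(0)`" in Cas18 Thm. 2.3 (and "`#ℤ_p/𝓕_E(0)`" in CGLS
Thm. 5.1.1) does not depend on the chosen generator. [cite: Castella2018, Thm. 2.3 (arXiv:1704.06608 p. 5)] -/
theorem valuation_constantCoeff_eq_of_span_singleton_eq {f g : IwasawaAlgebra p}
    (h : Ideal.span ({f} : Set (IwasawaAlgebra p)) = Ideal.span {g})
    (hf : PowerSeries.constantCoeff f ≠ 0) :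
    PowerSeries.constantCoeff g ≠ 0 ∧
      (PowerSeries.constantCoeff g).valuation = (PowerSeries.constantCoeff f).valuation := by
  obtain ⟨u, rfl⟩ := Ideal.span_singleton_eq_span_singleton.mp h
  have hu : IsUnit (PowerSeries.constantCoeff (u : IwasawaAlgebra p)) :=
    PowerSeries.isUnit_constantCoeff _ u.isUnit
  have hu0 : PowerSeries.constantCoeff (u : IwasawaAlgebra p) ≠ 0 := hu.ne_zero
  rw [map_mul]
  refine ⟨mul_ne_zero hf hu0, ?_⟩
  rw [PadicInt.valuation_mul hf hu0, padicInt_valuation_eq_zero_of_isUnit hu, add_zero]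

end Valuation

namespace XAc

variable (W : WeierstrassCurve K) (p : ℕ) [Fact p.Prime]
  (κ : ZpExtension K p) (𝔭 : HeightOneSpectrum (𝓞 K)) (S : Set (HeightOneSpectrum (𝓞 K)))
  (γ : absoluteGaloisGroup K) [Fact (κ.IsTopGenerator γ)]

/-- **"`X_ac^Σ(E[p^∞])` is `Λ`-torsion and `ord_p f_ac^Σ(0) = n`"** ON THE REAL MODULE: `X_ac^Σ` is a
torsion `Λ`-module, its characteristic ideal is principal with a generator `f` whose constant term
`f(0) ∈ ℤ_p` is non-zero of `p`-adic valuation `n` (so `#ℤ_p/f(0) = p^n`). The left-hand side of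
Cas18 Thm. 2.3's formula, of CGLS 2022 Thm. 5.1.1's formula ("`𝔛_E` is a torsion `Λ`-module, and
letting `𝓕_E ∈ Λ` be a generator of `char_Λ(𝔛_E)`, we have `#ℤ_p/𝓕_E(0) = …`") and of Castella §5
(5.1); by `HasCharValuationAt.unique` the number `n` does not depend on the generator. A predicate
with parameters; nothing asserted.
[cite: Castella2018, Thm. 2.3 and §5 (5.1) (arXiv:1704.06608 pp. 5, 12) (shape only; nothing asserted)]
[cite: CastellaGrossiLeeSkinner2022, Thm. 5.1.1 (left-hand side; shape only; nothing asserted)] -/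
def HasCharValuationAt (n : ℕ) : Prop :=
  Module.IsTorsion (IwasawaAlgebra p) (XAc W p κ 𝔭 S γ) ∧
    ∃ f : IwasawaAlgebra p, XAc.charIdeal W p κ 𝔭 S γ = Ideal.span {f} ∧
      PowerSeries.constantCoeff f ≠ 0 ∧ (PowerSeries.constantCoeff f).valuation = n

variable {W p κ 𝔭 S γ}

/-- `ord_p f_ac^Σ(0)` is well defined: two instances of `HasCharValuationAt` carry the same `n`.
[cite: Castella2018, Thm. 2.3 (arXiv:1704.06608 p. 5)] -/
theorem HasCharValuationAt.unique {m n : ℕ} (hm : HasCharValuationAt W p κ 𝔭 S γ m)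
    (hn : HasCharValuationAt W p κ 𝔭 S γ n) : m = n := by
  obtain ⟨_, f, hf, hf0, hfm⟩ := hm
  obtain ⟨_, g, hg, _, hgn⟩ := hn
  rw [← hfm, ← hgn]
  exact ((valuation_constantCoeff_eq_of_span_singleton_eq (hf.symm.trans hg) hf0).2).symm

/-- Introduction rule for `HasCharValuationAt`: a torsion module with a principal characteristic
ideal `(f)`, `f(0) ≠ 0`, `ord_p f(0) = n` has the shape at `n` (how a named fact stated with its own
`∃ 𝓕_E` — e.g. CGLS Thm. 5.1.1 — feeds the predicate). [cite: Castella2018, Thm. 2.3 (arXiv:1704.06608 p. 5)] -/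
theorem hasCharValuationAt_of_eq {n : ℕ} {f : IwasawaAlgebra p}
    (htors : Module.IsTorsion (IwasawaAlgebra p) (XAc W p κ 𝔭 S γ))
    (hf : XAc.charIdeal W p κ 𝔭 S γ = Ideal.span {f}) (hf0 : PowerSeries.constantCoeff f ≠ 0)
    (hn : (PowerSeries.constantCoeff f).valuation = n) : HasCharValuationAt W p κ 𝔭 S γ n :=
  ⟨htors, f, hf, hf0, hn⟩

end XAc

end Literature.NumberTheory.EllipticCurves.Castella2018.AcSelmer

end
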